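import Mathlib.Topology.Algebra.ClopenNhdofOne
import Mathlib.Topology.Algebra.OpenSubgroup
import Mathlib.GroupTheory.Index
import Literature.AnabelianGeometry.SemiGraphs.Coverticial
import Literature.AnabelianGeometry.Anabelioids.ProSigmaProofs
import HarnessLib

/-!
# Pro-`Σ` completions of discrete groups, I: open subgroups and finite `Σ`-quotients

[SemiAnbd] Example 2.10 (p. 31) speaks of "the maximal pro-`Σ` quotient of the fundamental group of a
hyperbolic Riemann surface of finite type", typed by abc-iut-L3-t1 as the interface
`SemiGraphOfAnabelioids.IsProSigmaCompletion Sigma ι` (`Coverticial.lean`): `ι : Γ → P` has dense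
image, open normal subgroups of `P` have `Σ`-integer index, and every normal subgroup of `Γ` of
`Σ`-integer index is the pull-back of an open subgroup of `P` [cite: MochizukiSemiAnbd2006, Ex. 2.10 p.31].
This file (theorems only, no definitions) is the plumbing over that interface needed to prove that such
completions of free groups are SLIM ([AbsAnab] Lemma 1.3.1; `ProSigmaCompletionSlim.lean`):

* an open subgroup `U ⊆ P` is recovered from `U₀ = ι⁻¹(U)`: `ι(U₀)` is dense in `U`, two open
  subgroups with the same pull-back coincide, `U` is normal as soon as `U₀` is, and `Γ → P/U` is
  surjective for open normal `U` (`closure_image_comap`, `eq_of_comap_eq`, `normal_of_comap_normal`,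
  `mk_comp_surjective`); for `P` profinite, `ι⁻¹(U)` has finite index and open subgroups have
  `Σ`-integer index;
* **a normal subgroup of `Σ`-index below a subnormal one** (`isSigmaInteger_index_normalCore`): if
  `A ⊴ Γ` has `Σ`-index and `K' ≤ A` is normalised by `A` with `[A : K']` a `Σ`-integer, then the normal
  core of `K'` in `Γ` has `Σ`-index (it contains the intersection of the finitely many conjugates
  `γ K' γ⁻¹`, `γ ∈ Γ/A`, each normal in `A`) — although the core of a NON-normal `Σ`-index subgroup
  need not have `Σ`-index;
* the extension of finite `Σ`-quotients of `ι⁻¹(U)` to continuous homomorphisms on `U` built on these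
  is in part II (`ProSigmaCompletionExtend.lean`).

No statement here takes a side on [IUTchIII] Cor. 3.12; this is plain (pro)finite group theory.
-/

namespace Literature.AnabelianGeometry.SemiGraphs.SemiGraphOfAnabelioids.IsProSigmaCompletion

open Literature.AnabelianGeometry.Anabelioids Topology

variable {Sigma : Set ℕ} {Γ : Type*} [Group Γ] {P : Type*} [Group P] [TopologicalSpace P]
  {ι : Γ →* P}

/-! ### `Σ`-integers: finite intersections of normal `Σ`-index subgroups -/

/-- A finite intersection of normal subgroups of `Σ`-integer index has `Σ`-integer index.
[cite: MochizukiSemiAnbd2006, Def. 2.9(i) p.31] -/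
theorem isSigmaInteger_index_iInf {G : Type*} [Group G] {κ : Type*} [Finite κ]
    (f : κ → Subgroup G) (hn : ∀ i, (f i).Normal) (h : ∀ i, IsSigmaInteger Sigma (f i).index) :
    IsSigmaInteger Sigma (⨅ i, f i).index := by
  classical
  haveI := Fintype.ofFinite κ
  suffices hs : ∀ s : Finset κ, IsSigmaInteger Sigma (⨅ i ∈ s, f i).index by
    have := hs Finset.univ
    simpa only [Finset.mem_univ, iInf_pos] using this
  intro s
  induction s using Finset.induction_on with
  | empty =>
    have : (⨅ i ∈ (∅ : Finset κ), f i) = ⊤ := by simp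
    rw [this, Subgroup.index_top]
    exact IsSigmaInteger.one Sigma
  | insert a s _ ih =>
    rw [Finset.iInf_insert]
    haveI := hn a
    exact (h a).index_inf ih

/-- **A normal subgroup of `Σ`-index inside a subnormal one.**  Let `A ⊴ Γ` have `Σ`-integer index and
let `K' ≤ A` be normalised by `A` with `[A : K']` a `Σ`-integer.  Then the normal core of `K'` in `Γ` has
`Σ`-integer index.  (The core contains `⋂_{γ ∈ Γ/A} γ K' γ⁻¹`, a finite intersection of normal
subgroups of `A` of index `[A : K']`.) [cite: MochizukiSemiAnbd2006, Def. 2.9(i) p.31] -/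
theorem isSigmaInteger_index_normalCore {G : Type*} [Group G] (A : Subgroup G) [hAn : A.Normal]
    (hA : IsSigmaInteger Sigma A.index) (K' : Subgroup G) (hK'A : K' ≤ A)
    (hnorm : ∀ a ∈ A, ∀ k ∈ K', a * k * a⁻¹ ∈ K') (hK' : IsSigmaInteger Sigma (K'.relIndex A)) :
    IsSigmaInteger Sigma K'.normalCore.index := by
  classical
  haveI : A.FiniteIndex := ⟨hA.1.ne'⟩
  -- the conjugates `γ K' γ⁻¹`, indexed by `Γ/A`
  let H : G ⧸ A → Subgroup G := fun q => K'.map (MulAut.conj q.out).toMonoidHom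
  have hH : ∀ g : G, H (QuotientGroup.mk g) = K'.map (MulAut.conj g).toMonoidHom := by
    intro g
    obtain ⟨a, ha⟩ := QuotientGroup.mk_out_eq_mul A g
    change K'.map (MulAut.conj ((QuotientGroup.mk g : G ⧸ A).out)).toMonoidHom = _
    rw [ha]
    ext x
    simp only [Subgroup.mem_map, MulEquiv.coe_toMonoidHom, MulAut.conj_apply]
    constructor
    · rintro ⟨k, hk, rfl⟩
      exact ⟨(a : G) * k * (a : G)⁻¹, hnorm a a.2 k hk, by group⟩
    · rintro ⟨k, hk, rfl⟩
      refine ⟨(a : G)⁻¹ * k * (a : G)⁻¹⁻¹, hnorm _ (A.inv_mem a.2) k hk, by group⟩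
  -- each conjugate lies in `A` and is normalised by `A`
  have hHA : ∀ q, H q ≤ A := by
    intro q
    rintro _ ⟨k, hk, rfl⟩
    exact hAn.conj_mem _ (hK'A hk) _
  have hHn : ∀ q, ∀ a ∈ A, ∀ x ∈ H q, a * x * a⁻¹ ∈ H q := by
    intro q a ha x hx
    obtain ⟨k, hk, rfl⟩ := hx
    have ha' : q.out⁻¹ * a * q.out⁻¹⁻¹ ∈ A := hAn.conj_mem a ha q.out⁻¹
    rw [inv_inv] at ha'
    refine ⟨(q.out⁻¹ * a * q.out) * k * (q.out⁻¹ * a * q.out)⁻¹, hnorm _ ha' k hk, ?_⟩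
    simp only [MulEquiv.coe_toMonoidHom, MulAut.conj_apply]
    group
  -- the intersection of the conjugates sits inside the normal core
  have hle : (⨅ q, H q) ≤ K'.normalCore := by
    intro x hx b
    have hxb : x ∈ H (QuotientGroup.mk b⁻¹) := (iInf_le H _) hx
    rw [hH b⁻¹] at hxb
    obtain ⟨k, hk, hkx⟩ := hxb
    have : b * x * b⁻¹ = k := by
      rw [← hkx]
      simp only [MulEquiv.coe_toMonoidHom, MulAut.conj_apply]
      group
    rw [this]
    exact hk
  -- index bookkeeping: `[Γ : ⋂ H_q] = [A : ⋂ H_q] · [Γ : A]`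
  have hIA : (⨅ q, H q) ≤ A := (iInf_le H (QuotientGroup.mk 1)).trans (hHA _)
  refine IsSigmaInteger.of_dvd ?_ (Subgroup.index_dvd_of_le hle)
  rw [← Subgroup.relIndex_mul_index hIA]
  refine IsSigmaInteger.mul ?_ hA
  -- pass to the group `A`
  have hrel : (⨅ q, H q).relIndex A = (⨅ q, (H q).subgroupOf A).index := by
    rw [Subgroup.relIndex, Subgroup.subgroupOf, Subgroup.comap_iInf]
    rfl
  rw [hrel]
  apply isSigmaInteger_index_iInf
  · intro q
    exact ⟨fun x hx a => hHn q a a.2 x hx⟩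
  · intro q
    change IsSigmaInteger Sigma ((H q).relIndex A)
    have hAq : A.map (MulAut.conj (q.out : G)).toMonoidHom = A := by
      ext x
      simp only [Subgroup.mem_map, MulEquiv.coe_toMonoidHom, MulAut.conj_apply]
      constructor
      · rintro ⟨y, hy, rfl⟩
        exact hAn.conj_mem _ hy _
      · intro hx
        refine ⟨q.out⁻¹ * x * q.out⁻¹⁻¹, hAn.conj_mem _ hx _, by group⟩
    have e : (H q).relIndex A = K'.relIndex A := by
      calc (H q).relIndex A
          = (K'.map (MulAut.conj (q.out : G)).toMonoidHom).relIndex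
              (A.map (MulAut.conj (q.out : G)).toMonoidHom) := by rw [hAq]
        _ = K'.relIndex A :=
            Subgroup.relIndex_map_map_of_injective K' A (MulAut.conj (q.out : G)).injective
    rw [e]
    exact hK'

/-! ### Open subgroups are determined by their pull-backs -/

/-- For an open subgroup `U ⊆ P`, the image `ι(ι⁻¹ U)` is dense in `U`: `U ⊆ closure ι(ι⁻¹ U)`.
[cite: MochizukiSemiAnbd2006, Ex. 2.10 p.31] -/
theorem le_closure_image_comap (hι : IsProSigmaCompletion Sigma ι) (U : Subgroup P)
    (hU : IsOpen (U : Set P)) : (U : Set P) ⊆ closure (ι '' (U.comap ι : Set Γ)) := by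
  have h := hι.dense.open_subset_closure_inter hU
  refine h.trans (closure_mono ?_)
  rintro x ⟨hxU, ⟨γ, rfl⟩⟩
  exact ⟨γ, hxU, rfl⟩

/-- For an open subgroup `U ⊆ P` of a topological group, `U` is the closure of `ι(ι⁻¹ U)`.
[cite: MochizukiSemiAnbd2006, Ex. 2.10 p.31] -/
theorem closure_image_comap [IsTopologicalGroup P] (hι : IsProSigmaCompletion Sigma ι)
    (U : Subgroup P) (hU : IsOpen (U : Set P)) :
    closure (ι '' (U.comap ι : Set Γ)) = (U : Set P) := by
  apply Set.Subset.antisymm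
  · refine closure_minimal ?_ (U.isClosed_of_isOpen hU)
    rintro x ⟨γ, hγ, rfl⟩
    exact hγ
  · exact le_closure_image_comap hι U hU

/-- Two open subgroups of `P` with the same pull-back to `Γ` are equal.
[cite: MochizukiSemiAnbd2006, Ex. 2.10 p.31] -/
theorem eq_of_comap_eq [IsTopologicalGroup P] (hι : IsProSigmaCompletion Sigma ι)
    {U V : Subgroup P} (hU : IsOpen (U : Set P)) (hV : IsOpen (V : Set P))
    (h : U.comap ι = V.comap ι) : U = V := by
  apply SetLike.coe_injective
  rw [← closure_image_comap hι U hU, ← closure_image_comap hι V hV, h]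

/-- Monotonicity: for open subgroups, `ι⁻¹ U ≤ ι⁻¹ V` implies `U ≤ V`.
[cite: MochizukiSemiAnbd2006, Ex. 2.10 p.31] -/
theorem le_of_comap_le [IsTopologicalGroup P] (hι : IsProSigmaCompletion Sigma ι)
    {U V : Subgroup P} (hU : IsOpen (U : Set P)) (hV : IsOpen (V : Set P))
    (h : U.comap ι ≤ V.comap ι) : U ≤ V := by
  intro x hx
  have hx' : x ∈ closure (ι '' (U.comap ι : Set Γ)) := le_closure_image_comap hι U hU hx
  rw [← SetLike.mem_coe, ← closure_image_comap hι V hV]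
  exact closure_mono (Set.image_mono h) hx'

omit [TopologicalSpace P] in
/-- The conjugate of a subgroup of `P` by `ι γ` pulls back to the conjugate of the pull-back.
[cite: MochizukiSemiAnbd2006, Ex. 2.10 p.31] -/
theorem comap_map_conj (U : Subgroup P) (γ : Γ) :
    (U.map (MulAut.conj (ι γ)).toMonoidHom).comap ι =
      (U.comap ι).map (MulAut.conj γ).toMonoidHom := by
  ext δ
  simp only [Subgroup.mem_comap, Subgroup.mem_map, MulEquiv.coe_toMonoidHom, MulAut.conj_apply]
  constructor
  · rintro ⟨x, hx, hxe⟩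
    refine ⟨γ⁻¹ * δ * γ, ?_, by group⟩
    have : ι (γ⁻¹ * δ * γ) = x := by
      rw [map_mul, map_mul, map_inv, ← hxe]
      group
    rw [this]
    exact hx
  · rintro ⟨x, hx, rfl⟩
    exact ⟨ι x, hx, by simp [map_mul, map_inv]⟩

/-- The conjugate of an open subgroup is open. [cite: MochizukiSemiAnbd2006, Ex. 2.10 p.31] -/
theorem isOpen_map_conj [IsTopologicalGroup P] (U : Subgroup P) (hU : IsOpen (U : Set P)) (x : P) :
    IsOpen ((U.map (MulAut.conj x).toMonoidHom : Subgroup P) : Set P) := by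
  have he : ((U.map (MulAut.conj x).toMonoidHom : Subgroup P) : Set P) =
      (Homeomorph.mulLeft x) '' ((Homeomorph.mulRight x⁻¹) '' (U : Set P)) := by
    rw [Subgroup.coe_map, Set.image_image]
    apply Set.image_congr
    intro y _
    simp [MulAut.conj_apply, mul_assoc]
  rw [he]
  exact (Homeomorph.mulLeft x).isOpenMap _ ((Homeomorph.mulRight x⁻¹).isOpenMap _ hU)

/-- An open subgroup of `P` whose pull-back to `Γ` is normal is itself normal (its normalizer is an
open, hence closed, subgroup containing the dense image of `Γ`).
[cite: MochizukiSemiAnbd2006, Ex. 2.10 p.31] -/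
theorem normal_of_comap_normal [IsTopologicalGroup P] (hι : IsProSigmaCompletion Sigma ι)
    (U : Subgroup P) (hU : IsOpen (U : Set P)) (hn : (U.comap ι).Normal) : U.Normal := by
  rw [← Subgroup.normalizer_eq_top_iff]
  -- `ι(Γ) ⊆ N(U)`: conjugating `U` by `ι γ` gives an open subgroup with the same pull-back
  have hconj : ∀ γ : Γ, U.map (MulAut.conj (ι γ)).toMonoidHom = U := by
    intro γ
    apply eq_of_comap_eq hι (isOpen_map_conj U hU (ι γ)) hU
    rw [comap_map_conj]
    ext x
    simp only [Subgroup.mem_map, MulEquiv.coe_toMonoidHom, MulAut.conj_apply]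
    constructor
    · rintro ⟨y, hy, rfl⟩
      exact hn.conj_mem y hy γ
    · intro hx
      refine ⟨γ⁻¹ * x * γ⁻¹⁻¹, hn.conj_mem x hx γ⁻¹, by group⟩
  have hsub : Set.range ι ⊆ (Subgroup.normalizer (U : Set P) : Set P) := by
    rintro _ ⟨γ, rfl⟩
    rw [SetLike.mem_coe, Subgroup.mem_set_normalizer_iff]
    intro n
    rw [SetLike.mem_coe, SetLike.mem_coe]
    constructor
    · intro h
      rw [← hconj γ]
      exact ⟨n, h, rfl⟩
    · intro h
      rw [← hconj γ] at h
      obtain ⟨m, hm, hme⟩ := h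
      simp only [MulEquiv.coe_toMonoidHom, MulAut.conj_apply, mul_left_inj, mul_right_inj] at hme
      rw [← hme]
      exact hm
  -- `N(U)` is open (it contains `U`), hence closed, hence everything
  have hopen : IsOpen (Subgroup.normalizer (U : Set P) : Set P) :=
    Subgroup.isOpen_mono Subgroup.le_normalizer hU
  have hclosed : IsClosed (Subgroup.normalizer (U : Set P) : Set P) :=
    Subgroup.isClosed_of_isOpen _ hopen
  rw [eq_top_iff]
  intro x _
  have hx : x ∈ closure (Set.range ι) := by rw [hι.dense.closure_eq]; trivial
  exact hclosed.closure_subset_iff.mpr hsub hx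

/-- For an open subgroup `U ⊆ P` and `x ∈ P`, the coset `x U` meets `ι(Γ)`.
[cite: MochizukiSemiAnbd2006, Ex. 2.10 p.31] -/
theorem exists_mem_coset [IsTopologicalGroup P] (hι : IsProSigmaCompletion Sigma ι)
    (U : Subgroup P) (hU : IsOpen (U : Set P)) (x : P) : ∃ γ : Γ, x⁻¹ * ι γ ∈ U := by
  have hopen : IsOpen ((Homeomorph.mulLeft x) '' (U : Set P)) :=
    (Homeomorph.mulLeft x).isOpenMap _ hU
  obtain ⟨_, hγ, ⟨γ, rfl⟩⟩ := hι.dense.inter_open_nonempty _ hopen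
    ⟨x, ⟨1, U.one_mem, by simp⟩⟩
  obtain ⟨u, hu, hγu⟩ := hγ
  refine ⟨γ, ?_⟩
  have : ι γ = x * u := hγu.symm
  rw [this, inv_mul_cancel_left]
  exact hu

/-- For an open normal subgroup `U ⊆ P`, the composite `Γ → P → P ⧸ U` is surjective (every coset is
open and meets the dense image of `Γ`). [cite: MochizukiSemiAnbd2006, Ex. 2.10 p.31] -/
theorem mk_comp_surjective [IsTopologicalGroup P] (hι : IsProSigmaCompletion Sigma ι)
    (U : Subgroup P) [U.Normal] (hU : IsOpen (U : Set P)) :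
    Function.Surjective ((QuotientGroup.mk' U).comp ι) := by
  intro q
  obtain ⟨x, rfl⟩ := QuotientGroup.mk_surjective q
  obtain ⟨γ, hγ⟩ := exists_mem_coset hι U hU x
  refine ⟨γ, ?_⟩
  change (QuotientGroup.mk (ι γ) : P ⧸ U) = QuotientGroup.mk x
  rw [eq_comm, QuotientGroup.eq]
  exact hγ

/-! ### Indices -/

/-- For an open normal subgroup `U`, `ι` induces a bijection `Γ ⧸ ι⁻¹(U) ≃ P ⧸ U`.
[cite: MochizukiSemiAnbd2006, Ex. 2.10 p.31] -/
theorem bijective_quotientMap [IsTopologicalGroup P] (hι : IsProSigmaCompletion Sigma ι)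
    (U : Subgroup P) [U.Normal] (hU : IsOpen (U : Set P)) :
    Function.Bijective (QuotientGroup.map (U.comap ι) U ι le_rfl) := by
  constructor
  · rw [← MonoidHom.ker_eq_bot_iff, eq_bot_iff]
    intro q hq
    obtain ⟨γ, rfl⟩ := QuotientGroup.mk_surjective q
    rw [MonoidHom.mem_ker, QuotientGroup.map_mk, QuotientGroup.eq_one_iff] at hq
    rw [Subgroup.mem_bot, QuotientGroup.eq_one_iff, Subgroup.mem_comap]
    exact hq
  · intro q
    obtain ⟨γ, hγ⟩ := mk_comp_surjective hι U hU q
    exact ⟨QuotientGroup.mk γ, by rw [QuotientGroup.map_mk]; exact hγ⟩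

/-- For an open normal subgroup `U ⊆ P`, `(ι⁻¹ U).index = U.index`.
[cite: MochizukiSemiAnbd2006, Ex. 2.10 p.31] -/
theorem index_comap_of_normal [IsTopologicalGroup P] (hι : IsProSigmaCompletion Sigma ι)
    (U : Subgroup P) [U.Normal] (hU : IsOpen (U : Set P)) : (U.comap ι).index = U.index := by
  rw [Subgroup.index_eq_card, Subgroup.index_eq_card]
  exact Nat.card_congr (Equiv.ofBijective _ (bijective_quotientMap hι U hU))

section Profinite

variable [IsTopologicalGroup P] [CompactSpace P] [TotallyDisconnectedSpace P]

/-- In a profinite `P`, every open subgroup contains an open normal subgroup (Mathlib).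
[cite: MochizukiSemiAnbd2006, Ex. 2.10 p.31] -/
theorem exists_openNormal_le (U : Subgroup P) (hU : IsOpen (U : Set P)) :
    ∃ N : OpenNormalSubgroup P, (N : Subgroup P) ≤ U := by
  obtain ⟨N, hN⟩ := ProfiniteGrp.exist_openNormalSubgroup_sub_open_nhds_of_one hU U.one_mem
  exact ⟨N, fun x hx => hN hx⟩

/-- Open subgroups of a pro-`Σ` completion have `Σ`-integer index.
[cite: MochizukiSemiAnbd2006, Ex. 2.10 p.31] -/
theorem isSigmaInteger_index (hι : IsProSigmaCompletion Sigma ι) (U : Subgroup P)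
    (hU : IsOpen (U : Set P)) : IsSigmaInteger Sigma U.index := by
  obtain ⟨N, hN⟩ := exists_openNormal_le U hU
  exact (hι.index_open N N.isNormal' N.isOpen').of_dvd (Subgroup.index_dvd_of_le hN)

/-- The pull-back of an open normal subgroup has `Σ`-integer index in `Γ`.
[cite: MochizukiSemiAnbd2006, Ex. 2.10 p.31] -/
theorem isSigmaInteger_index_comap (hι : IsProSigmaCompletion Sigma ι) (U : Subgroup P)
    [U.Normal] (hU : IsOpen (U : Set P)) : IsSigmaInteger Sigma (U.comap ι).index := by
  rw [index_comap_of_normal hι U hU]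
  exact isSigmaInteger_index hι U hU

/-- The pull-back of an open subgroup has finite index in `Γ`.
[cite: MochizukiSemiAnbd2006, Ex. 2.10 p.31] -/
theorem finiteIndex_comap (hι : IsProSigmaCompletion Sigma ι) (U : Subgroup P)
    (hU : IsOpen (U : Set P)) : (U.comap ι).FiniteIndex := by
  obtain ⟨N, hN⟩ := exists_openNormal_le U hU
  haveI : (N : Subgroup P).Normal := N.isNormal'
  have h := isSigmaInteger_index_comap hι (N : Subgroup P) N.isOpen'
  haveI : ((N : Subgroup P).comap ι).FiniteIndex := ⟨h.1.ne'⟩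
  exact Subgroup.finiteIndex_of_le (Subgroup.comap_mono hN)

end Profinite

end Literature.AnabelianGeometry.SemiGraphs.SemiGraphOfAnabelioids.IsProSigmaCompletion
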